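import Literature.Geometry.Kaehler.TorusDolbeaultPerturbation
import Literature.Geometry.Kaehler.ChartTorusL2
import Literature.Analysis.FunctionSpaces.LatticeLaplaceLikeAdjoint
import Mathlib.Analysis.Calculus.BumpFunction.InnerProduct
import HarnessLib

/-!
# Existence of good cut-off data at a point (Warner 6.31: "choose `O₀` small enough")

F. W. Warner, GTM 94 (1983), 6.31–6.32: the neighbourhood `O₀` of the point is chosen so small that
the periodic operator `L̃` built from cut-off coefficients is elliptic with small principal
perturbation. For the torus `∂̄`-Laplacian (`TorusDolbeaultLaplacian`, `TorusDolbeaultPerturbation`)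
we construct, at every point `p` and for every `δ > 0` and every neighbourhood `U` of the chart
point, cut-off data `𝒞 : CubeCutoff p A` (radii and a smooth bump `χ`, Mathlib's `ContDiffBump`)
whose outer cube region lies in `U`, on which the chart sign is a nonzero constant
(`exists_good_cubeRegion`) and the four derivative-coefficient fields oscillate by at most `δ`
(`exists_cubeCutoff_oscLE`).

Second part (Warner 6.32, the formal adjoint in the weak equation): the flat adjoint `L̃†` of the
torus Laplacian (`Lattice.laplaceLikeAdj` of the first-order constituents; `torusLaplacianAdj`, with
degree-`0`/top companions), whose frozen symbol is the same real scalar `-½‖ξ_k♯‖²`, hence elliptic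
with the same constant and with the same perturbation bound `δ·K` (`eNorm_conv_adjSymb_le`); good
data at every point for `L̃†` (`exists_goodDataAdj{,Zero,Top}`).

## References

* F. W. Warner, GTM 94 (1983), 6.24, 6.31, 6.32. [WarnerGTM94]
-/

noncomputable section

open scoped Manifold ContDiff Topology NNReal ENNReal RealInnerProductSpace
open Bundle Set Function Module Metric Filter
open Literature.Analysis.FunctionSpaces Literature.NumberTheory.Transcendental

set_option maxSynthPendingDepth 2

namespace Literature.Geometry.Kaehler

/-! ### Oscillation of the coefficient fields near the chart point -/

section Osc

variable {E : Type*} [NormedAddCommGroup E] [NormedSpace ℝ E] {n : ℕ}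
  {M : Type*} [TopologicalSpace M] [ChartedSpace E M]
  {F F' : Type*} [NormedAddCommGroup F] [NormedSpace ℂ F] [NormedAddCommGroup F'] [NormedSpace ℂ F']
  {k k' : ℕ}
  {V W : Type*} [NormedAddCommGroup V] [NormedSpace ℂ V] [NormedAddCommGroup W] [NormedSpace ℂ W]
  [FiniteDimensional ℂ V] [FiniteDimensional ℂ W]
  {Q : ChartOp1 E F F' k k'} {p : M} {A : E ≃L[ℝ] EuclideanSpace ℝ (Fin n)}
  {ι : (E [⋀^Fin k]→L[ℝ] F) ≃L[ℂ] V} {ι' : (E [⋀^Fin k']→L[ℝ] F') ≃L[ℂ] W}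

/-- **Near the chart point the derivative coefficients oscillate by at most `δ`** (continuity).
[folklore] -/
theorem ChartOp1.eventually_norm_dirCoeff_sub_le (hQ : Q.SmoothOn (extChartAt 𝓘(ℝ, E) p).target)
    (hBI : ∀ y D, Q.B y (Complex.I • D) = Complex.I • Q.B y D) {δ : ℝ} (hδ : 0 < δ) :
    ∀ᶠ y in 𝓝 (extChartAt 𝓘(ℝ, E) p p), ∀ j,
      ‖Q.dirCoeff A ι ι' hBI j y - Q.dirCoeff A ι ι' hBI j (extChartAt 𝓘(ℝ, E) p p)‖ ≤ δ := by
  refine eventually_all.2 fun j ↦ ?_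
  have hc : ContinuousAt (Q.dirCoeff A ι ι' hBI j) (extChartAt 𝓘(ℝ, E) p p) :=
    (ChartOp1.contDiffOn_dirCoeff hQ hBI j).continuousOn.continuousAt
      ((isOpen_extChartAt_target p).mem_nhds (mem_extChartAt_target p))
  filter_upwards [hc.preimage_mem_nhds (closedBall_mem_nhds _ hδ)] with y hy
  rwa [Set.mem_preimage, mem_closedBall, dist_eq_norm] at hy

end Osc

/-! ### A cube cut-off from radii -/

section OfRadius

variable {E : Type*} [NormedAddCommGroup E] [NormedSpace ℝ E] {n : ℕ}
  {M : Type*} [TopologicalSpace M] [ChartedSpace E M]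

/-- **A cube cut-off from radii** `0 < ρ' < ½` with `K_{ρ'}` inside the target: inner radius
`ρ = ρ'/2` and a smooth bump equal to `1` on `closedBall c₀ ρ`, supported in `closedBall c₀ (3ρ'/4)`.
[cite: WarnerGTM94, 6.31] -/
def CubeCutoff.ofRadius (p : M) (A : E ≃L[ℝ] EuclideanSpace ℝ (Fin n)) {ρ' : ℝ} (hρ0 : 0 < ρ') (hρ' : ρ' < 1 / 2)
    (hKt : cubeRegion A (extChartAt 𝓘(ℝ, E) p p) ρ' ⊆ (extChartAt 𝓘(ℝ, E) p).target) : CubeCutoff p A :=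
  let f : ContDiffBump (Torus.cubeCenter (Fin n)) := ⟨ρ' / 2, 3 * ρ' / 4, by positivity, by linarith⟩
  { χ := f
    ρ := ρ' / 2
    ρ' := ρ'
    ρ_pos := by positivity
    ρ_lt := by linarith
    ρ'_lt := hρ'
    contDiff := f.contDiff
    eq_one := fun z hz ↦ f.one_of_mem_closedBall hz
    tsupport_subset := by
      rw [f.tsupport_eq]
      exact closedBall_subset_closedBall (show 3 * ρ' / 4 ≤ ρ' by linarith)
    abs_le := fun z ↦ _root_.abs_le.2 ⟨by linarith [f.nonneg (x := z)], f.le_one⟩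
    region_subset := hKt }

/-- The outer radius of `CubeCutoff.ofRadius`. [folklore] -/
@[simp] theorem CubeCutoff.ofRadius_ρ' (p : M) (A : E ≃L[ℝ] EuclideanSpace ℝ (Fin n)) {ρ' : ℝ} (hρ0 : 0 < ρ')
    (hρ' : ρ' < 1 / 2) (hKt : cubeRegion A (extChartAt 𝓘(ℝ, E) p p) ρ' ⊆ (extChartAt 𝓘(ℝ, E) p).target) :
    (CubeCutoff.ofRadius p A hρ0 hρ' hKt).ρ' = ρ' := rfl

end OfRadius

/-! ### The construction -/

section Construct

variable {E : Type*} [NormedAddCommGroup E] [NormedSpace ℂ E] [FiniteDimensional ℂ E]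
  {n : ℕ} [Fact (finrank ℝ E = n)]
  {M : Type*} [TopologicalSpace M] [ChartedSpace E M] [IsManifold 𝓘(ℝ, E) ∞ M]
  [RiemannianBundle (fun x : M ↦ TangentSpace 𝓘(ℝ, E) x)]
  [IsContMDiffRiemannianBundle 𝓘(ℝ, E) ∞ E (fun x : M ↦ TangentSpace 𝓘(ℝ, E) x)]
  [IsContinuousRiemannianBundle E (fun x : M ↦ TangentSpace 𝓘(ℝ, E) x)]
  (o : (x : M) → Orientation ℝ (TangentSpace 𝓘(ℝ, E) x) (Fin n)) {k m m' : ℕ}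

/-- **Good cut-off data exist at every point**: for `δ > 0` and a neighbourhood `U` of the chart
point there is a cube cut-off whose outer region lies in `U`, on which the chart sign is a nonzero
constant and the four derivative-coefficient fields of `∂̄`, `∂̄*` oscillate by at most `δ`
(Warner 6.31). [cite: WarnerGTM94, 6.31] -/
theorem exists_cubeCutoff_oscLE (ho : IsSmoothForm (riemannianVolumeForm o)) (h₁ : (k + 1) + m = n)
    (h₃ : (k + 1 + 1) + m' = n) (p : M) (A : E ≃L[ℝ] EuclideanSpace ℝ (Fin n)) {δ : ℝ} (hδ : 0 < δ)
    {U : Set E} (hU : U ∈ 𝓝 (extChartAt 𝓘(ℝ, E) p p)) :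
    ∃ 𝒞 : CubeCutoff p A, cubeRegion A (extChartAt 𝓘(ℝ, E) p p) 𝒞.ρ' ⊆ U ∧ OscLE o h₁ h₃ 𝒞 δ ∧
      ∃ ε : ℝ, ε ≠ 0 ∧ ∀ y ∈ cubeRegion A (extChartAt 𝓘(ℝ, E) p p) 𝒞.ρ', chartSign o p y = ε := by
  -- the four oscillation neighbourhoods
  have e1 := ChartOp1.eventually_norm_dirCoeff_sub_le (A := A) (ι := fibreIso E k) (ι' := fibreIso E (k + 1))
    (smoothOn_dolbeaultBarOp (k := k) (isOpen_extChartAt_target p)) commI_dolbeaultBarOp.B hδ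
  have e2 := ChartOp1.eventually_norm_dirCoeff_sub_le (A := A) (ι := fibreIso E (k + 1)) (ι' := fibreIso E (k + 1 + 1))
    (smoothOn_dolbeaultBarOp (k := k + 1) (isOpen_extChartAt_target p)) commI_dolbeaultBarOp.B hδ
  have e3 := ChartOp1.eventually_norm_dirCoeff_sub_le (A := A) (ι := fibreIso E (k + 1)) (ι' := fibreIso E k)
    (smoothOn_dolbeaultBarAdjointOp o ho h₁ p) (commI_dolbeaultBarAdjointOp o h₁ p).B hδ
  have e4 := ChartOp1.eventually_norm_dirCoeff_sub_le (A := A) (ι := fibreIso E (k + 1 + 1)) (ι' := fibreIso E (k + 1))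
    (smoothOn_dolbeaultBarAdjointOp o ho h₃ p) (commI_dolbeaultBarAdjointOp o h₃ p).B hδ
  obtain ⟨ρ', hρ0, hρ', hKt, hKW, ε, hε, hsign⟩ :=
    exists_good_cubeRegion o ho p A (inter_mem hU (e1.and (e2.and (e3.and e4))))
  refine ⟨CubeCutoff.ofRadius p A hρ0 hρ' hKt, fun y hy ↦ (hKW hy).1, ?_, ε, hε, fun y hy ↦ hsign y hy⟩
  exact ⟨fun j y hy ↦ (hKW hy).2.1 j, fun j y hy ↦ (hKW hy).2.2.1 j,
    fun j y hy ↦ (hKW hy).2.2.2.1 j, fun j y hy ↦ (hKW hy).2.2.2.2 j⟩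

omit [IsContMDiffRiemannianBundle 𝓘(ℝ, E) ∞ E (fun x : M ↦ TangentSpace 𝓘(ℝ, E) x)] in
/-- **A cube cut-off inside any neighbourhood of the chart point, with constant nonzero chart sign
on its outer region.** [cite: WarnerGTM94, 6.31] -/
theorem exists_cubeCutoff_subset (ho : IsSmoothForm (riemannianVolumeForm o)) (p : M)
    (A : E ≃L[ℝ] EuclideanSpace ℝ (Fin n)) {U : Set E} (hU : U ∈ 𝓝 (extChartAt 𝓘(ℝ, E) p p)) :
    ∃ 𝒞 : CubeCutoff p A, cubeRegion A (extChartAt 𝓘(ℝ, E) p p) 𝒞.ρ' ⊆ U ∧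
      ∃ ε : ℝ, ε ≠ 0 ∧ ∀ y ∈ cubeRegion A (extChartAt 𝓘(ℝ, E) p p) 𝒞.ρ', chartSign o p y = ε := by
  obtain ⟨ρ', hρ0, hρ', hKt, hKW, ε, hε, hsign⟩ := exists_good_cubeRegion o ho p A hU
  exact ⟨CubeCutoff.ofRadius p A hρ0 hρ' hKt, hKW, ε, hε, fun y hy ↦ hsign y hy⟩

/-- Good cut-off data for the degree-`0` torus Laplacian. [cite: WarnerGTM94, 6.31] -/
theorem exists_cubeCutoff_oscLEZero (ho : IsSmoothForm (riemannianVolumeForm o)) (h₃ : (0 + 1) + m' = n)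
    (p : M) (A : E ≃L[ℝ] EuclideanSpace ℝ (Fin n)) {δ : ℝ} (hδ : 0 < δ) :
    ∃ 𝒞 : CubeCutoff p A, OscLEZero o h₃ 𝒞 δ ∧
      ∃ ε : ℝ, ε ≠ 0 ∧ ∀ y ∈ cubeRegion A (extChartAt 𝓘(ℝ, E) p p) 𝒞.ρ', chartSign o p y = ε := by
  have e1 := ChartOp1.eventually_norm_dirCoeff_sub_le (A := A) (ι := fibreIso E 0) (ι' := fibreIso E (0 + 1))
    (smoothOn_dolbeaultBarOp (k := 0) (isOpen_extChartAt_target p)) commI_dolbeaultBarOp.B hδ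
  have e3 := ChartOp1.eventually_norm_dirCoeff_sub_le (A := A) (ι := fibreIso E (0 + 1)) (ι' := fibreIso E 0)
    (smoothOn_dolbeaultBarAdjointOp o ho h₃ p) (commI_dolbeaultBarAdjointOp o h₃ p).B hδ
  obtain ⟨𝒞, hKW, ε, hε, hsign⟩ := exists_cubeCutoff_subset o ho p A (e1.and e3)
  exact ⟨𝒞, ⟨fun j y hy ↦ (hKW hy).1 j, fun j y hy ↦ (hKW hy).2 j⟩, ε, hε, hsign⟩

/-- Good cut-off data for the top-degree torus Laplacian. [cite: WarnerGTM94, 6.31] -/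
theorem exists_cubeCutoff_oscLETop (ho : IsSmoothForm (riemannianVolumeForm o)) (h₁ : (k + 1) + 0 = n)
    (p : M) (A : E ≃L[ℝ] EuclideanSpace ℝ (Fin n)) {δ : ℝ} (hδ : 0 < δ) :
    ∃ 𝒞 : CubeCutoff p A, OscLETop o h₁ 𝒞 δ ∧
      ∃ ε : ℝ, ε ≠ 0 ∧ ∀ y ∈ cubeRegion A (extChartAt 𝓘(ℝ, E) p p) 𝒞.ρ', chartSign o p y = ε := by
  have e1 := ChartOp1.eventually_norm_dirCoeff_sub_le (A := A) (ι := fibreIso E k) (ι' := fibreIso E (k + 1))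
    (smoothOn_dolbeaultBarOp (k := k) (isOpen_extChartAt_target p)) commI_dolbeaultBarOp.B hδ
  have e3 := ChartOp1.eventually_norm_dirCoeff_sub_le (A := A) (ι := fibreIso E (k + 1)) (ι' := fibreIso E k)
    (smoothOn_dolbeaultBarAdjointOp o ho h₁ p) (commI_dolbeaultBarAdjointOp o h₁ p).B hδ
  obtain ⟨𝒞, hKW, ε, hε, hsign⟩ := exists_cubeCutoff_subset o ho p A (e1.and e3)
  exact ⟨𝒞, ⟨fun j y hy ↦ (hKW hy).1 j, fun j y hy ↦ (hKW hy).2 j⟩, ε, hε, hsign⟩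

/-! ### Good data at a point: ellipticity, small perturbation, constant sign -/

/-- Smallness arithmetic: for finite `a, K` there is `δ ∈ (0, 1]` with `a (δ K) ≤ 1`. [folklore] -/
theorem exists_delta_small {a K : ℝ≥0∞} (ha : a ≠ ⊤) (hK : K ≠ ⊤) :
    ∃ δ : ℝ, 0 < δ ∧ δ ≤ 1 ∧ a * (ENNReal.ofReal δ * K) ≤ 1 := by
  set Q : ℝ≥0∞ := a * K with hQ
  have hQt : Q ≠ ⊤ := ENNReal.mul_ne_top ha hK
  have hq0 : 0 ≤ Q.toReal := ENNReal.toReal_nonneg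
  refine ⟨1 / (Q.toReal + 1), by positivity, ?_, ?_⟩
  · rw [div_le_one (by positivity)]; linarith
  · have e : a * (ENNReal.ofReal (1 / (Q.toReal + 1)) * K) = ENNReal.ofReal (1 / (Q.toReal + 1) * Q.toReal) := by
      rw [ENNReal.ofReal_mul (by positivity), ENNReal.ofReal_toReal hQt, hQ, mul_left_comm]
    rw [e, ← ENNReal.ofReal_one]
    refine ENNReal.ofReal_le_ofReal ?_
    rw [div_mul_eq_mul_div, one_mul, div_le_one (by positivity)]
    linarith

/-- The cube map at a point: any real-linear identification `E ≃ ℝⁿ`. [folklore] -/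
def cubeMapChoice (E : Type*) [NormedAddCommGroup E] [NormedSpace ℂ E] [FiniteDimensional ℂ E] {n : ℕ}
    [Fact (finrank ℝ E = n)] : E ≃L[ℝ] EuclideanSpace ℝ (Fin n) :=
  ContinuousLinearEquiv.ofFinrankEq (by rw [finrank_euclideanSpace_fin]; exact Fact.out)

/-- **Good data at a point, generic degree** (Warner 6.31 + 6.35): a cube map, cut-off data, an
ellipticity constant and a perturbation bound satisfying the smallness condition of the fundamental
inequality, and a constant chart sign on the inner region. [cite: WarnerGTM94, 6.31] -/
theorem exists_goodData (ho : IsSmoothForm (riemannianVolumeForm o))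
    (hH : ∀ (x : M) (v w : TangentSpace 𝓘(ℝ, E) x), ⟪tangentJ E x v, tangentJ E x w⟫ = ⟪v, w⟫)
    (h₁ : (k + 1) + m = n) (h₃ : (k + 1 + 1) + m' = n) (p : M) :
    ∃ (A : E ≃L[ℝ] EuclideanSpace ℝ (Fin n)) (𝒞 : CubeCutoff p A) (κ : ℝ) (ε : ℝ≥0∞) (εs : ℝ),
      0 < κ ∧ (torusLaplacian o ho h₁ h₃ 𝒞).IsEllipticWith κ ∧
      (torusLaplacian o ho h₁ h₃ 𝒞).PrincipalPerturbationLE ε ∧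
      ENNReal.ofReal (2 * Real.sqrt 2 / κ) * (Fintype.card (Fin n) : ℝ≥0∞) ^ 2 * ε ≤ 1 ∧
      ∀ y ∈ cubeRegion A (extChartAt 𝓘(ℝ, E) p p) 𝒞.ρ, chartSign o p y = εs := by
  set A := cubeMapChoice E (n := n)
  obtain ⟨κ, hκ, hell⟩ := torusLaplacian_isEllipticWith o ho hH h₁ h₃ p A
  obtain ⟨δ, hδ, hδ1, hsmall⟩ := exists_delta_small (K := perturbationConst o h₁ h₃ p A)
    (a := ENNReal.ofReal (2 * Real.sqrt 2 / κ) * (Fintype.card (Fin n) : ℝ≥0∞) ^ 2)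
    (ENNReal.mul_ne_top ENNReal.ofReal_ne_top (ENNReal.pow_ne_top (ENNReal.natCast_ne_top _)))
    (perturbationConst_lt_top o h₁ h₃ p A).ne
  obtain ⟨𝒞, -, hosc, εs, -, hsign⟩ := exists_cubeCutoff_oscLE o ho h₁ h₃ p A hδ univ_mem
  exact ⟨A, 𝒞, κ, _, εs, hκ, hell 𝒞, torusLaplacian_principalPerturbationLE o ho h₁ h₃ 𝒞 hδ.le hδ1 hosc, hsmall,
    fun y hy ↦ hsign y (𝒞.region_mono hy)⟩

/-- Good data at a point, degree `0`. [cite: WarnerGTM94, 6.31] -/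
theorem exists_goodDataZero (ho : IsSmoothForm (riemannianVolumeForm o))
    (hH : ∀ (x : M) (v w : TangentSpace 𝓘(ℝ, E) x), ⟪tangentJ E x v, tangentJ E x w⟫ = ⟪v, w⟫)
    (h₃ : (0 + 1) + m' = n) (p : M) :
    ∃ (A : E ≃L[ℝ] EuclideanSpace ℝ (Fin n)) (𝒞 : CubeCutoff p A) (κ : ℝ) (ε : ℝ≥0∞) (εs : ℝ),
      0 < κ ∧ (torusLaplacianZero o ho h₃ 𝒞).IsEllipticWith κ ∧
      (torusLaplacianZero o ho h₃ 𝒞).PrincipalPerturbationLE ε ∧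
      ENNReal.ofReal (2 * Real.sqrt 2 / κ) * (Fintype.card (Fin n) : ℝ≥0∞) ^ 2 * ε ≤ 1 ∧
      ∀ y ∈ cubeRegion A (extChartAt 𝓘(ℝ, E) p p) 𝒞.ρ, chartSign o p y = εs := by
  set A := cubeMapChoice E (n := n)
  obtain ⟨κ, hκ, hell⟩ := torusLaplacianZero_isEllipticWith o ho hH h₃ p A
  obtain ⟨δ, hδ, hδ1, hsmall⟩ := exists_delta_small (K := perturbationConstZero o h₃ p A)
    (a := ENNReal.ofReal (2 * Real.sqrt 2 / κ) * (Fintype.card (Fin n) : ℝ≥0∞) ^ 2)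
    (ENNReal.mul_ne_top ENNReal.ofReal_ne_top (ENNReal.pow_ne_top (ENNReal.natCast_ne_top _)))
    (perturbationConstZero_lt_top o h₃ p A).ne
  obtain ⟨𝒞, hosc, εs, -, hsign⟩ := exists_cubeCutoff_oscLEZero o ho h₃ p A hδ
  exact ⟨A, 𝒞, κ, _, εs, hκ, hell 𝒞, torusLaplacianZero_principalPerturbationLE o ho h₃ 𝒞 hδ.le hδ1 hosc, hsmall,
    fun y hy ↦ hsign y (𝒞.region_mono hy)⟩

/-- Good data at a point, top degree. [cite: WarnerGTM94, 6.31] -/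
theorem exists_goodDataTop (ho : IsSmoothForm (riemannianVolumeForm o))
    (hH : ∀ (x : M) (v w : TangentSpace 𝓘(ℝ, E) x), ⟪tangentJ E x v, tangentJ E x w⟫ = ⟪v, w⟫)
    (h₁ : (k + 1) + 0 = n) (p : M) :
    ∃ (A : E ≃L[ℝ] EuclideanSpace ℝ (Fin n)) (𝒞 : CubeCutoff p A) (κ : ℝ) (ε : ℝ≥0∞) (εs : ℝ),
      0 < κ ∧ (torusLaplacianTop o ho h₁ 𝒞).IsEllipticWith κ ∧
      (torusLaplacianTop o ho h₁ 𝒞).PrincipalPerturbationLE ε ∧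
      ENNReal.ofReal (2 * Real.sqrt 2 / κ) * (Fintype.card (Fin n) : ℝ≥0∞) ^ 2 * ε ≤ 1 ∧
      ∀ y ∈ cubeRegion A (extChartAt 𝓘(ℝ, E) p p) 𝒞.ρ, chartSign o p y = εs := by
  set A := cubeMapChoice E (n := n)
  obtain ⟨κ, hκ, hell⟩ := torusLaplacianTop_isEllipticWith o ho hH h₁ p A
  obtain ⟨δ, hδ, hδ1, hsmall⟩ := exists_delta_small (K := perturbationConstTop o h₁ p A)
    (a := ENNReal.ofReal (2 * Real.sqrt 2 / κ) * (Fintype.card (Fin n) : ℝ≥0∞) ^ 2)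
    (ENNReal.mul_ne_top ENNReal.ofReal_ne_top (ENNReal.pow_ne_top (ENNReal.natCast_ne_top _)))
    (perturbationConstTop_lt_top o h₁ p A).ne
  obtain ⟨𝒞, hosc, εs, -, hsign⟩ := exists_cubeCutoff_oscLETop o ho h₁ p A hδ
  exact ⟨A, 𝒞, κ, _, εs, hκ, hell 𝒞, torusLaplacianTop_principalPerturbationLE o ho h₁ 𝒞 hδ.le hδ1 hosc, hsmall,
    fun y hy ↦ hsign y (𝒞.region_mono hy)⟩

end Construct

/-! ## Part 2: the flat adjoint `L̃†` -/

section AdjointPart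

open Complex Literature.Analysis.FunctionSpaces.Torus

/-! ### Lattice helpers -/

section LatticeHelpers

/-- `‖-c‖_s = ‖c‖_s`. [folklore] -/
theorem Lattice.eNorm_neg {d : Type*} [Fintype d] {V : Type*} [NormedAddCommGroup V] [NormedSpace ℂ V] (s : ℝ)
    (c : (d → ℤ) → V) : Lattice.eNorm s (-c) = Lattice.eNorm s c := by
  rw [Lattice.eNorm_eq_rpow, Lattice.eNorm_eq_rpow, Lattice.eNormSq_neg]

variable {d : Type*} [Fintype d] {V W : Type*} [NormedAddCommGroup V] [InnerProductSpace ℂ V]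
  [NormedAddCommGroup W] [InnerProductSpace ℂ W] [CompleteSpace V] [CompleteSpace W]

/-- The frozen coefficients of the adjoint have the same norms. [folklore] -/
theorem Lattice.POp1.enorm_adj_P (P : Lattice.POp1 d V W) (j : d) : ‖P.adj.P j‖ₑ = ‖P.P j‖ₑ := by
  rw [Lattice.POp1.adj_P, enorm_neg, ← ofReal_norm, ← ofReal_norm, LinearIsometryEquiv.norm_map]

/-- **Perturbation bounds pass to the adjoint operator**: if the perturbation symbols of `P` act
with norm `≤ δ` on `H₀`, so do those of `P†`. [folklore] -/
theorem Lattice.POp1.eNorm_conv_adj_p_le (P : Lattice.POp1 d V W) {δ : ℝ}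
    (h : ∀ i (c : (d → ℤ) → V), Lattice.eNormSq 0 c < ⊤ →
      Lattice.eNorm 0 (Lattice.conv (P.p i) c) ≤ ENNReal.ofReal δ * Lattice.eNorm 0 c)
    (i : d) (c : (d → ℤ) → W) (hc : Lattice.eNormSq 0 c < ⊤) :
    Lattice.eNorm 0 (Lattice.conv (P.adj.p i) c) ≤ ENNReal.ofReal δ * Lattice.eNorm 0 c := by
  rw [Lattice.POp1.adj_p, Lattice.neg_conv, Lattice.eNorm_neg]
  exact Lattice.eNorm_conv_adjSymb_le (P.hp i) ENNReal.ofReal_ne_top (h i) c hc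

/-- **Perturbation bound for `(PQ)† = Q†P†`** from the bounds for `P`, `Q` (`δ ≤ 1`). [folklore] -/
theorem Lattice.compAdj_principalPerturbationLE (P : Lattice.POp1 d W V) (Q : Lattice.POp1 d V W) {δ : ℝ}
    (hδ1 : δ ≤ 1)
    (hp : ∀ i (c : (d → ℤ) → W), Lattice.eNormSq 0 c < ⊤ →
      Lattice.eNorm 0 (Lattice.conv (P.p i) c) ≤ ENNReal.ofReal δ * Lattice.eNorm 0 c)
    (hq : ∀ i (c : (d → ℤ) → V), Lattice.eNormSq 0 c < ⊤ →
      Lattice.eNorm 0 (Lattice.conv (Q.p i) c) ≤ ENNReal.ofReal δ * Lattice.eNorm 0 c)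
    (MP MQ : ℝ≥0∞) (hMP : ∀ i, ‖P.P i‖ₑ ≤ MP) (hMQ : ∀ i, ‖Q.P i‖ₑ ≤ MQ) :
    (Lattice.compAdj P Q).PrincipalPerturbationLE (ENNReal.ofReal δ * (MP + MQ + 1)) := by
  intro i j c hc
  refine (Lattice.POp1.principalPerturbationLE_comp Q.adj P.adj
    (fun i c hc ↦ Lattice.POp1.eNorm_conv_adj_p_le Q hq i c hc)
    (fun i c hc ↦ Lattice.POp1.eNorm_conv_adj_p_le P hp i c hc) MQ MP
    (fun i ↦ (Lattice.POp1.enorm_adj_P Q i).trans_le (hMQ i))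
    (fun i ↦ (Lattice.POp1.enorm_adj_P P i).trans_le (hMP i)) i j c hc).trans ?_
  rw [add_comm MP MQ]
  exact mul_le_mul' (comp_bound_le hδ1) le_rfl

/-- The adjoint of a real scalar operator is itself. [folklore] -/
theorem adjoint_neg_real_smul_id (c : ℝ) :
    ContinuousLinearMap.adjoint (-((c : ℂ) • ContinuousLinearMap.id ℂ V)) = -((c : ℂ) • ContinuousLinearMap.id ℂ V) := by
  rw [map_neg, LinearIsometryEquiv.map_smulₛₗ, ContinuousLinearMap.adjoint_id]
  simp

end LatticeHelpers

/-! ### The adjoint torus Laplacians -/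

section Laplacian

variable {E : Type*} [NormedAddCommGroup E] [NormedSpace ℂ E] [FiniteDimensional ℂ E]
  {n : ℕ} [Fact (finrank ℝ E = n)]
  {M : Type*} [TopologicalSpace M] [ChartedSpace E M] [IsManifold 𝓘(ℝ, E) ∞ M]
  [RiemannianBundle (fun x : M ↦ TangentSpace 𝓘(ℝ, E) x)]
  [IsContMDiffRiemannianBundle 𝓘(ℝ, E) ∞ E (fun x : M ↦ TangentSpace 𝓘(ℝ, E) x)]
  (o : (x : M) → Orientation ℝ (TangentSpace 𝓘(ℝ, E) x) (Fin n)) {k m m' : ℕ}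

/-- **The flat adjoint `L̃†` of the torus Laplacian** (generic degree). [cite: WarnerGTM94, 6.32] -/
def torusLaplacianAdj (ho : IsSmoothForm (riemannianVolumeForm o)) (h₁ : (k + 1) + m = n) (h₃ : (k + 1 + 1) + m' = n)
    {p : M} {A : E ≃L[ℝ] EuclideanSpace ℝ (Fin n)} (𝒞 : CubeCutoff p A) :
    Lattice.POp (Fin n) (EuclideanSpace ℂ (Fin (fibreDim E (k + 1)))) (EuclideanSpace ℂ (Fin (fibreDim E (k + 1)))) :=
  Lattice.laplaceLikeAdj (torusDolbeaultBar k 𝒞).toPOp1 (torusDolbeaultBarAdjoint o ho h₁ 𝒞).toPOp1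
    (torusDolbeaultBarAdjoint o ho h₃ 𝒞).toPOp1 (torusDolbeaultBar (k + 1) 𝒞).toPOp1

/-- The flat adjoint of the degree-`0` torus Laplacian. [cite: WarnerGTM94, 6.32] -/
def torusLaplacianZeroAdj (ho : IsSmoothForm (riemannianVolumeForm o)) (h₃ : (0 + 1) + m' = n)
    {p : M} {A : E ≃L[ℝ] EuclideanSpace ℝ (Fin n)} (𝒞 : CubeCutoff p A) :
    Lattice.POp (Fin n) (EuclideanSpace ℂ (Fin (fibreDim E 0))) (EuclideanSpace ℂ (Fin (fibreDim E 0))) :=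
  Lattice.compAdj (torusDolbeaultBarAdjoint o ho h₃ 𝒞).toPOp1 (torusDolbeaultBar 0 𝒞).toPOp1

/-- The flat adjoint of the top-degree torus Laplacian. [cite: WarnerGTM94, 6.32] -/
def torusLaplacianTopAdj (ho : IsSmoothForm (riemannianVolumeForm o)) (h₁ : (k + 1) + 0 = n)
    {p : M} {A : E ≃L[ℝ] EuclideanSpace ℝ (Fin n)} (𝒞 : CubeCutoff p A) :
    Lattice.POp (Fin n) (EuclideanSpace ℂ (Fin (fibreDim E (k + 1)))) (EuclideanSpace ℂ (Fin (fibreDim E (k + 1)))) :=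
  Lattice.compAdj (torusDolbeaultBar k 𝒞).toPOp1 (torusDolbeaultBarAdjoint o ho h₁ 𝒞).toPOp1

/-- The symbol of `L̃` as an operator: the scalar `-½‖ξ_k♯‖² · id`. [folklore] -/
theorem torusLaplacian_symbol_eq (ho : IsSmoothForm (riemannianVolumeForm o))
    (hH : ∀ (x : M) (v w : TangentSpace 𝓘(ℝ, E) x), ⟪tangentJ E x v, tangentJ E x w⟫ = ⟪v, w⟫)
    (h₁ : (k + 1) + m = n) (h₃ : (k + 1 + 1) + m' = n) {p : M} {A : E ≃L[ℝ] EuclideanSpace ℝ (Fin n)}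
    (𝒞 : CubeCutoff p A) (kv : Fin n → ℤ) :
    (torusLaplacian o ho h₁ h₃ 𝒞).symbol kv =
      -(((2⁻¹ * ‖(InnerProductSpace.toDual ℝ (TangentSpace 𝓘(ℝ, E) p)).symm (freqCovector A kv)‖ ^ 2 : ℝ) : ℂ) •
        ContinuousLinearMap.id ℂ _) := by
  ext1 v
  rw [torusLaplacian_symbol o ho hH h₁ h₃ 𝒞 kv v]
  simp

/-- **The frozen symbol of `L̃†` is the same scalar.** [cite: WarnerGTM94, 6.32] -/
theorem torusLaplacianAdj_symbol (ho : IsSmoothForm (riemannianVolumeForm o))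
    (hH : ∀ (x : M) (v w : TangentSpace 𝓘(ℝ, E) x), ⟪tangentJ E x v, tangentJ E x w⟫ = ⟪v, w⟫)
    (h₁ : (k + 1) + m = n) (h₃ : (k + 1 + 1) + m' = n) {p : M} {A : E ≃L[ℝ] EuclideanSpace ℝ (Fin n)}
    (𝒞 : CubeCutoff p A) (kv : Fin n → ℤ) (v : EuclideanSpace ℂ (Fin (fibreDim E (k + 1)))) :
    (torusLaplacianAdj o ho h₁ h₃ 𝒞).symbol kv v =
      -(((2⁻¹ * ‖(InnerProductSpace.toDual ℝ (TangentSpace 𝓘(ℝ, E) p)).symm (freqCovector A kv)‖ ^ 2 : ℝ) : ℂ) • v) := by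
  have h := Lattice.laplaceLikeAdj_symbol (torusDolbeaultBar k 𝒞).toPOp1 (torusDolbeaultBarAdjoint o ho h₁ 𝒞).toPOp1
    (torusDolbeaultBarAdjoint o ho h₃ 𝒞).toPOp1 (torusDolbeaultBar (k + 1) 𝒞).toPOp1 kv
  rw [torusLaplacianAdj, h, show ((torusDolbeaultBar k 𝒞).toPOp1.comp (torusDolbeaultBarAdjoint o ho h₁ 𝒞).toPOp1).add
      ((torusDolbeaultBarAdjoint o ho h₃ 𝒞).toPOp1.comp (torusDolbeaultBar (k + 1) 𝒞).toPOp1) =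
      torusLaplacian o ho h₁ h₃ 𝒞 from rfl, torusLaplacian_symbol_eq o ho hH h₁ h₃ 𝒞 kv, adjoint_neg_real_smul_id]
  simp

/-- The symbol of the degree-`0` Laplacian as an operator. [folklore] -/
theorem torusLaplacianZero_symbol_eq (ho : IsSmoothForm (riemannianVolumeForm o))
    (hH : ∀ (x : M) (v w : TangentSpace 𝓘(ℝ, E) x), ⟪tangentJ E x v, tangentJ E x w⟫ = ⟪v, w⟫)
    (h₃ : (0 + 1) + m' = n) {p : M} {A : E ≃L[ℝ] EuclideanSpace ℝ (Fin n)} (𝒞 : CubeCutoff p A) (kv : Fin n → ℤ) :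
    (torusLaplacianZero o ho h₃ 𝒞).symbol kv =
      -(((2⁻¹ * ‖(InnerProductSpace.toDual ℝ (TangentSpace 𝓘(ℝ, E) p)).symm (freqCovector A kv)‖ ^ 2 : ℝ) : ℂ) •
        ContinuousLinearMap.id ℂ _) := by
  ext1 v
  rw [torusLaplacianZero_symbol o ho hH h₃ 𝒞 kv v]
  simp

/-- The frozen symbol of the degree-`0` adjoint. [cite: WarnerGTM94, 6.32] -/
theorem torusLaplacianZeroAdj_symbol (ho : IsSmoothForm (riemannianVolumeForm o))
    (hH : ∀ (x : M) (v w : TangentSpace 𝓘(ℝ, E) x), ⟪tangentJ E x v, tangentJ E x w⟫ = ⟪v, w⟫)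
    (h₃ : (0 + 1) + m' = n) {p : M} {A : E ≃L[ℝ] EuclideanSpace ℝ (Fin n)}
    (𝒞 : CubeCutoff p A) (kv : Fin n → ℤ) (v : EuclideanSpace ℂ (Fin (fibreDim E 0))) :
    (torusLaplacianZeroAdj o ho h₃ 𝒞).symbol kv v =
      -(((2⁻¹ * ‖(InnerProductSpace.toDual ℝ (TangentSpace 𝓘(ℝ, E) p)).symm (freqCovector A kv)‖ ^ 2 : ℝ) : ℂ) • v) := by
  rw [torusLaplacianZeroAdj, Lattice.compAdj_symbol, show (torusDolbeaultBarAdjoint o ho h₃ 𝒞).toPOp1.comp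
      (torusDolbeaultBar 0 𝒞).toPOp1 = torusLaplacianZero o ho h₃ 𝒞 from rfl,
    torusLaplacianZero_symbol_eq o ho hH h₃ 𝒞 kv, adjoint_neg_real_smul_id]
  simp

/-- The symbol of the top-degree Laplacian as an operator. [folklore] -/
theorem torusLaplacianTop_symbol_eq (ho : IsSmoothForm (riemannianVolumeForm o))
    (hH : ∀ (x : M) (v w : TangentSpace 𝓘(ℝ, E) x), ⟪tangentJ E x v, tangentJ E x w⟫ = ⟪v, w⟫)
    (h₁ : (k + 1) + 0 = n) {p : M} {A : E ≃L[ℝ] EuclideanSpace ℝ (Fin n)} (𝒞 : CubeCutoff p A) (kv : Fin n → ℤ) :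
    (torusLaplacianTop o ho h₁ 𝒞).symbol kv =
      -(((2⁻¹ * ‖(InnerProductSpace.toDual ℝ (TangentSpace 𝓘(ℝ, E) p)).symm (freqCovector A kv)‖ ^ 2 : ℝ) : ℂ) •
        ContinuousLinearMap.id ℂ _) := by
  ext1 v
  rw [torusLaplacianTop_symbol o ho hH h₁ 𝒞 kv v]
  simp

/-- The frozen symbol of the top-degree adjoint. [cite: WarnerGTM94, 6.32] -/
theorem torusLaplacianTopAdj_symbol (ho : IsSmoothForm (riemannianVolumeForm o))
    (hH : ∀ (x : M) (v w : TangentSpace 𝓘(ℝ, E) x), ⟪tangentJ E x v, tangentJ E x w⟫ = ⟪v, w⟫)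
    (h₁ : (k + 1) + 0 = n) {p : M} {A : E ≃L[ℝ] EuclideanSpace ℝ (Fin n)}
    (𝒞 : CubeCutoff p A) (kv : Fin n → ℤ) (v : EuclideanSpace ℂ (Fin (fibreDim E (k + 1)))) :
    (torusLaplacianTopAdj o ho h₁ 𝒞).symbol kv v =
      -(((2⁻¹ * ‖(InnerProductSpace.toDual ℝ (TangentSpace 𝓘(ℝ, E) p)).symm (freqCovector A kv)‖ ^ 2 : ℝ) : ℂ) • v) := by
  rw [torusLaplacianTopAdj, Lattice.compAdj_symbol, show (torusDolbeaultBar k 𝒞).toPOp1.comp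
      (torusDolbeaultBarAdjoint o ho h₁ 𝒞).toPOp1 = torusLaplacianTop o ho h₁ 𝒞 from rfl,
    torusLaplacianTop_symbol_eq o ho hH h₁ 𝒞 kv, adjoint_neg_real_smul_id]
  simp

/-- **`L̃†` is elliptic** with a constant depending only on the point and the cube map.
[cite: WarnerGTM94, 6.32] -/
theorem torusLaplacianAdj_isEllipticWith (ho : IsSmoothForm (riemannianVolumeForm o))
    (hH : ∀ (x : M) (v w : TangentSpace 𝓘(ℝ, E) x), ⟪tangentJ E x v, tangentJ E x w⟫ = ⟪v, w⟫)
    (h₁ : (k + 1) + m = n) (h₃ : (k + 1 + 1) + m' = n) (p : M) (A : E ≃L[ℝ] EuclideanSpace ℝ (Fin n)) :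
    ∃ κ : ℝ, 0 < κ ∧ ∀ 𝒞 : CubeCutoff p A, (torusLaplacianAdj o ho h₁ h₃ 𝒞).IsEllipticWith κ := by
  obtain ⟨C, hC, hge⟩ := norm_toDual_symm_freqCovector_ge (I := 𝓘(ℝ, E)) p A
  refine ⟨C / 2, by positivity, fun 𝒞 ↦ ?_⟩
  refine Lattice.POp.isEllipticWith_of_symbol_eq_neg_smul _
    (c := fun kv ↦ 2⁻¹ * ‖(InnerProductSpace.toDual ℝ (TangentSpace 𝓘(ℝ, E) p)).symm (freqCovector A kv)‖ ^ 2)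
    (fun kv v ↦ torusLaplacianAdj_symbol o ho hH h₁ h₃ 𝒞 kv v) (fun kv ↦ ?_) (fun kv ↦ by positivity)
  have := hge kv
  linarith

/-- The degree-`0` adjoint is elliptic. [cite: WarnerGTM94, 6.32] -/
theorem torusLaplacianZeroAdj_isEllipticWith (ho : IsSmoothForm (riemannianVolumeForm o))
    (hH : ∀ (x : M) (v w : TangentSpace 𝓘(ℝ, E) x), ⟪tangentJ E x v, tangentJ E x w⟫ = ⟪v, w⟫)
    (h₃ : (0 + 1) + m' = n) (p : M) (A : E ≃L[ℝ] EuclideanSpace ℝ (Fin n)) :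
    ∃ κ : ℝ, 0 < κ ∧ ∀ 𝒞 : CubeCutoff p A, (torusLaplacianZeroAdj o ho h₃ 𝒞).IsEllipticWith κ := by
  obtain ⟨C, hC, hge⟩ := norm_toDual_symm_freqCovector_ge (I := 𝓘(ℝ, E)) p A
  refine ⟨C / 2, by positivity, fun 𝒞 ↦ ?_⟩
  refine Lattice.POp.isEllipticWith_of_symbol_eq_neg_smul _
    (c := fun kv ↦ 2⁻¹ * ‖(InnerProductSpace.toDual ℝ (TangentSpace 𝓘(ℝ, E) p)).symm (freqCovector A kv)‖ ^ 2)
    (fun kv v ↦ torusLaplacianZeroAdj_symbol o ho hH h₃ 𝒞 kv v) (fun kv ↦ ?_) (fun kv ↦ by positivity)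
  have := hge kv
  linarith

/-- The top-degree adjoint is elliptic. [cite: WarnerGTM94, 6.32] -/
theorem torusLaplacianTopAdj_isEllipticWith (ho : IsSmoothForm (riemannianVolumeForm o))
    (hH : ∀ (x : M) (v w : TangentSpace 𝓘(ℝ, E) x), ⟪tangentJ E x v, tangentJ E x w⟫ = ⟪v, w⟫)
    (h₁ : (k + 1) + 0 = n) (p : M) (A : E ≃L[ℝ] EuclideanSpace ℝ (Fin n)) :
    ∃ κ : ℝ, 0 < κ ∧ ∀ 𝒞 : CubeCutoff p A, (torusLaplacianTopAdj o ho h₁ 𝒞).IsEllipticWith κ := by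
  obtain ⟨C, hC, hge⟩ := norm_toDual_symm_freqCovector_ge (I := 𝓘(ℝ, E)) p A
  refine ⟨C / 2, by positivity, fun 𝒞 ↦ ?_⟩
  refine Lattice.POp.isEllipticWith_of_symbol_eq_neg_smul _
    (c := fun kv ↦ 2⁻¹ * ‖(InnerProductSpace.toDual ℝ (TangentSpace 𝓘(ℝ, E) p)).symm (freqCovector A kv)‖ ^ 2)
    (fun kv v ↦ torusLaplacianTopAdj_symbol o ho hH h₁ 𝒞 kv v) (fun kv ↦ ?_) (fun kv ↦ by positivity)
  have := hge kv
  linarith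

/-! ### Small perturbation of the adjoints -/

/-- **Perturbation bound for `L̃†`** (same `δ·K` as for `L̃`). [cite: WarnerGTM94, 6.32] -/
theorem torusLaplacianAdj_principalPerturbationLE (ho : IsSmoothForm (riemannianVolumeForm o))
    (h₁ : (k + 1) + m = n) (h₃ : (k + 1 + 1) + m' = n) {p : M} {A : E ≃L[ℝ] EuclideanSpace ℝ (Fin n)}
    (𝒞 : CubeCutoff p A) {δ : ℝ} (hδ : 0 ≤ δ) (hδ1 : δ ≤ 1) (hosc : OscLE o h₁ h₃ 𝒞 δ) :
    (torusLaplacianAdj o ho h₁ h₃ 𝒞).PrincipalPerturbationLE (ENNReal.ofReal δ * perturbationConst o h₁ h₃ p A) := by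
  rw [perturbationConst, mul_add]
  exact Lattice.POp.principalPerturbationLE_add
    (Lattice.compAdj_principalPerturbationLE _ _ hδ1
      (fun i c hc ↦ ChartOp1.eNorm_conv_toPOp1_p_le 𝒞 _ _ _ hδ hosc.dbar_k i c hc)
      (fun i c hc ↦ ChartOp1.eNorm_conv_toPOp1_p_le 𝒞 _ _ _ hδ hosc.adj_k i c hc) _ _
      (fun i ↦ ChartOp1.enorm_toPOp1_P_le 𝒞 _ _ _ i) (fun i ↦ ChartOp1.enorm_toPOp1_P_le 𝒞 _ _ _ i))
    (Lattice.compAdj_principalPerturbationLE _ _ hδ1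
      (fun i c hc ↦ ChartOp1.eNorm_conv_toPOp1_p_le 𝒞 _ _ _ hδ hosc.adj_succ i c hc)
      (fun i c hc ↦ ChartOp1.eNorm_conv_toPOp1_p_le 𝒞 _ _ _ hδ hosc.dbar_succ i c hc) _ _
      (fun i ↦ ChartOp1.enorm_toPOp1_P_le 𝒞 _ _ _ i) (fun i ↦ ChartOp1.enorm_toPOp1_P_le 𝒞 _ _ _ i))

/-- Perturbation bound for the degree-`0` adjoint. [cite: WarnerGTM94, 6.32] -/
theorem torusLaplacianZeroAdj_principalPerturbationLE (ho : IsSmoothForm (riemannianVolumeForm o))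
    (h₃ : (0 + 1) + m' = n) {p : M} {A : E ≃L[ℝ] EuclideanSpace ℝ (Fin n)}
    (𝒞 : CubeCutoff p A) {δ : ℝ} (hδ : 0 ≤ δ) (hδ1 : δ ≤ 1) (hosc : OscLEZero o h₃ 𝒞 δ) :
    (torusLaplacianZeroAdj o ho h₃ 𝒞).PrincipalPerturbationLE (ENNReal.ofReal δ * perturbationConstZero o h₃ p A) :=
  Lattice.compAdj_principalPerturbationLE _ _ hδ1
    (fun i c hc ↦ ChartOp1.eNorm_conv_toPOp1_p_le 𝒞 _ _ _ hδ hosc.adj i c hc)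
    (fun i c hc ↦ ChartOp1.eNorm_conv_toPOp1_p_le 𝒞 _ _ _ hδ hosc.dbar i c hc) _ _
    (fun i ↦ ChartOp1.enorm_toPOp1_P_le 𝒞 _ _ _ i) (fun i ↦ ChartOp1.enorm_toPOp1_P_le 𝒞 _ _ _ i)

/-- Perturbation bound for the top-degree adjoint. [cite: WarnerGTM94, 6.32] -/
theorem torusLaplacianTopAdj_principalPerturbationLE (ho : IsSmoothForm (riemannianVolumeForm o))
    (h₁ : (k + 1) + 0 = n) {p : M} {A : E ≃L[ℝ] EuclideanSpace ℝ (Fin n)}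
    (𝒞 : CubeCutoff p A) {δ : ℝ} (hδ : 0 ≤ δ) (hδ1 : δ ≤ 1) (hosc : OscLETop o h₁ 𝒞 δ) :
    (torusLaplacianTopAdj o ho h₁ 𝒞).PrincipalPerturbationLE (ENNReal.ofReal δ * perturbationConstTop o h₁ p A) :=
  Lattice.compAdj_principalPerturbationLE _ _ hδ1
    (fun i c hc ↦ ChartOp1.eNorm_conv_toPOp1_p_le 𝒞 _ _ _ hδ hosc.dbar i c hc)
    (fun i c hc ↦ ChartOp1.eNorm_conv_toPOp1_p_le 𝒞 _ _ _ hδ hosc.adj i c hc) _ _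
    (fun i ↦ ChartOp1.enorm_toPOp1_P_le 𝒞 _ _ _ i) (fun i ↦ ChartOp1.enorm_toPOp1_P_le 𝒞 _ _ _ i)

end Laplacian

/-! ### Good data for the adjoints at a point -/

section GoodData

variable {E : Type*} [NormedAddCommGroup E] [NormedSpace ℂ E] [FiniteDimensional ℂ E]
  {n : ℕ} [Fact (finrank ℝ E = n)]
  {M : Type*} [TopologicalSpace M] [ChartedSpace E M] [IsManifold 𝓘(ℝ, E) ∞ M]
  [RiemannianBundle (fun x : M ↦ TangentSpace 𝓘(ℝ, E) x)]
  [IsContMDiffRiemannianBundle 𝓘(ℝ, E) ∞ E (fun x : M ↦ TangentSpace 𝓘(ℝ, E) x)]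
  [IsContinuousRiemannianBundle E (fun x : M ↦ TangentSpace 𝓘(ℝ, E) x)]
  (o : (x : M) → Orientation ℝ (TangentSpace 𝓘(ℝ, E) x) (Fin n)) {k m m' : ℕ}

/-- **Good data for `L̃†` at a point, generic degree** (ellipticity, small perturbation, constant
chart sign). [cite: WarnerGTM94, 6.32] -/
theorem exists_goodDataAdj (ho : IsSmoothForm (riemannianVolumeForm o))
    (hH : ∀ (x : M) (v w : TangentSpace 𝓘(ℝ, E) x), ⟪tangentJ E x v, tangentJ E x w⟫ = ⟪v, w⟫)
    (h₁ : (k + 1) + m = n) (h₃ : (k + 1 + 1) + m' = n) (p : M) :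
    ∃ (A : E ≃L[ℝ] EuclideanSpace ℝ (Fin n)) (𝒞 : CubeCutoff p A) (κ : ℝ) (ε : ℝ≥0∞) (εs : ℝ),
      0 < κ ∧ (torusLaplacianAdj o ho h₁ h₃ 𝒞).IsEllipticWith κ ∧
      (torusLaplacianAdj o ho h₁ h₃ 𝒞).PrincipalPerturbationLE ε ∧
      ENNReal.ofReal (2 * Real.sqrt 2 / κ) * (Fintype.card (Fin n) : ℝ≥0∞) ^ 2 * ε ≤ 1 ∧
      ∀ y ∈ cubeRegion A (extChartAt 𝓘(ℝ, E) p p) 𝒞.ρ, chartSign o p y = εs := by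
  set A := cubeMapChoice E (n := n)
  obtain ⟨κ, hκ, hell⟩ := torusLaplacianAdj_isEllipticWith o ho hH h₁ h₃ p A
  obtain ⟨δ, hδ, hδ1, hsmall⟩ := exists_delta_small (K := perturbationConst o h₁ h₃ p A)
    (a := ENNReal.ofReal (2 * Real.sqrt 2 / κ) * (Fintype.card (Fin n) : ℝ≥0∞) ^ 2)
    (ENNReal.mul_ne_top ENNReal.ofReal_ne_top (ENNReal.pow_ne_top (ENNReal.natCast_ne_top _)))
    (perturbationConst_lt_top o h₁ h₃ p A).ne
  obtain ⟨𝒞, -, hosc, εs, -, hsign⟩ := exists_cubeCutoff_oscLE o ho h₁ h₃ p A hδ univ_mem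
  exact ⟨A, 𝒞, κ, _, εs, hκ, hell 𝒞, torusLaplacianAdj_principalPerturbationLE o ho h₁ h₃ 𝒞 hδ.le hδ1 hosc, hsmall,
    fun y hy ↦ hsign y (𝒞.region_mono hy)⟩

/-- Good data for the degree-`0` adjoint. [cite: WarnerGTM94, 6.32] -/
theorem exists_goodDataZeroAdj (ho : IsSmoothForm (riemannianVolumeForm o))
    (hH : ∀ (x : M) (v w : TangentSpace 𝓘(ℝ, E) x), ⟪tangentJ E x v, tangentJ E x w⟫ = ⟪v, w⟫)
    (h₃ : (0 + 1) + m' = n) (p : M) :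
    ∃ (A : E ≃L[ℝ] EuclideanSpace ℝ (Fin n)) (𝒞 : CubeCutoff p A) (κ : ℝ) (ε : ℝ≥0∞) (εs : ℝ),
      0 < κ ∧ (torusLaplacianZeroAdj o ho h₃ 𝒞).IsEllipticWith κ ∧
      (torusLaplacianZeroAdj o ho h₃ 𝒞).PrincipalPerturbationLE ε ∧
      ENNReal.ofReal (2 * Real.sqrt 2 / κ) * (Fintype.card (Fin n) : ℝ≥0∞) ^ 2 * ε ≤ 1 ∧
      ∀ y ∈ cubeRegion A (extChartAt 𝓘(ℝ, E) p p) 𝒞.ρ, chartSign o p y = εs := by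
  set A := cubeMapChoice E (n := n)
  obtain ⟨κ, hκ, hell⟩ := torusLaplacianZeroAdj_isEllipticWith o ho hH h₃ p A
  obtain ⟨δ, hδ, hδ1, hsmall⟩ := exists_delta_small (K := perturbationConstZero o h₃ p A)
    (a := ENNReal.ofReal (2 * Real.sqrt 2 / κ) * (Fintype.card (Fin n) : ℝ≥0∞) ^ 2)
    (ENNReal.mul_ne_top ENNReal.ofReal_ne_top (ENNReal.pow_ne_top (ENNReal.natCast_ne_top _)))
    (perturbationConstZero_lt_top o h₃ p A).ne
  obtain ⟨𝒞, hosc, εs, -, hsign⟩ := exists_cubeCutoff_oscLEZero o ho h₃ p A hδ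
  exact ⟨A, 𝒞, κ, _, εs, hκ, hell 𝒞, torusLaplacianZeroAdj_principalPerturbationLE o ho h₃ 𝒞 hδ.le hδ1 hosc, hsmall,
    fun y hy ↦ hsign y (𝒞.region_mono hy)⟩

/-- Good data for the top-degree adjoint. [cite: WarnerGTM94, 6.32] -/
theorem exists_goodDataTopAdj (ho : IsSmoothForm (riemannianVolumeForm o))
    (hH : ∀ (x : M) (v w : TangentSpace 𝓘(ℝ, E) x), ⟪tangentJ E x v, tangentJ E x w⟫ = ⟪v, w⟫)
    (h₁ : (k + 1) + 0 = n) (p : M) :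
    ∃ (A : E ≃L[ℝ] EuclideanSpace ℝ (Fin n)) (𝒞 : CubeCutoff p A) (κ : ℝ) (ε : ℝ≥0∞) (εs : ℝ),
      0 < κ ∧ (torusLaplacianTopAdj o ho h₁ 𝒞).IsEllipticWith κ ∧
      (torusLaplacianTopAdj o ho h₁ 𝒞).PrincipalPerturbationLE ε ∧
      ENNReal.ofReal (2 * Real.sqrt 2 / κ) * (Fintype.card (Fin n) : ℝ≥0∞) ^ 2 * ε ≤ 1 ∧
      ∀ y ∈ cubeRegion A (extChartAt 𝓘(ℝ, E) p p) 𝒞.ρ, chartSign o p y = εs := by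
  set A := cubeMapChoice E (n := n)
  obtain ⟨κ, hκ, hell⟩ := torusLaplacianTopAdj_isEllipticWith o ho hH h₁ p A
  obtain ⟨δ, hδ, hδ1, hsmall⟩ := exists_delta_small (K := perturbationConstTop o h₁ p A)
    (a := ENNReal.ofReal (2 * Real.sqrt 2 / κ) * (Fintype.card (Fin n) : ℝ≥0∞) ^ 2)
    (ENNReal.mul_ne_top ENNReal.ofReal_ne_top (ENNReal.pow_ne_top (ENNReal.natCast_ne_top _)))
    (perturbationConstTop_lt_top o h₁ p A).ne
  obtain ⟨𝒞, hosc, εs, -, hsign⟩ := exists_cubeCutoff_oscLETop o ho h₁ p A hδ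
  exact ⟨A, 𝒞, κ, _, εs, hκ, hell 𝒞, torusLaplacianTopAdj_principalPerturbationLE o ho h₁ 𝒞 hδ.le hδ1 hosc, hsmall,
    fun y hy ↦ hsign y (𝒞.region_mono hy)⟩

end GoodData

end AdjointPart

end Literature.Geometry.Kaehler
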